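import Summits.AnomalousDissipation.AnomalousDissipation.Theorems.MarginalStabilityChainStrainedLayerLawClockReduction
import HarnessLib

/-!
# Crux `MarginalStabilityChain.StrainedLayerLaw` (stmt-AnomalousDissipation-3007), line `FirstLemmasR2K4`
# (log-enstrophy clock + Nash roundness): the EXPONENTIAL LAW of the negative enstrophy

Support file (`--supports stmt-AnomalousDissipation-3007`; registered sub-goal `negEnstrophy_exp_law` of line
`FirstLemmasR2K4`, lead c7, wave 1).

What it proves: along every classical solution `(u, v, p)` of the stretched layer class on `(0, ∞)` (viscosity
`ν > 0`, period `L > 0`) with shear tails on every compact time interval `[a, b] ⊂ (0, ∞)`, for `0 < s ≤ t`: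

* `Ω₋(t) ≤ e^{t−s} Ω₋(s)` — the landed clock law `Ω₋′ = Ω₋ − 2νP₋` (`stub_negEnstrophyLaw` fed with
  `stub_levelSetNull`) and `P₋ ≥ 0` (`negPalinstrophy_nonneg`) make `τ ↦ e^{−τ} Ω₋(τ)` antitone on `(0, ∞)`
  (its derivative is `−2ν e^{−τ} P₋(τ) ≤ 0`; `antitoneOn_of_hasDerivWithinAt_nonpos`);
* the CUMULATIVE NEGATIVE-PALINSTROPHY BUDGET `∫_s^t 2νP₋ ≤ e^{t−s} Ω₋(s)` — rearrange the landed integral identity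
  `Ω₋(t) − Ω₋(s) = ∫_s^t (Ω₋ − 2νP₋)` (`clock_negEnstrophy_identity`) as `∫_s^t 2νP₋ = Ω₋(s) − Ω₋(t) + ∫_s^t Ω₋`,
  bound `∫_s^t Ω₋ ≤ ∫_s^t e^{τ−s} Ω₋(s) dτ = (e^{t−s} − 1) Ω₋(s)` by the first item, and drop `Ω₋(t) ≥ 0`
  (`negEnstrophy_nonneg`).

Interval integrability of `Ω₋` and `2νP₋` on `[s, t]` comes from the continuity of `Ω₋` (it is differentiable) and of
`Ω₋ − 2νP₋` (`clock_negEnstrophy_continuousOn`) on `(0, ∞)`, exactly as in `clock_log_identity`. No facts are asserted;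
all `[folklore]` (Grönwall for a linear differential inequality).
-/

-- `Summit.<Summit>.<Problem>` is the tree's mandated summit-side namespace (CONVENTIONS §2); for this
-- single-conjunct summit the two coincide, so the duplicate is deliberate.
set_option linter.dupNamespace false

noncomputable section

open scoped Topology ENNReal
open Filter Set Function MeasureTheory

namespace Summit.AnomalousDissipation.AnomalousDissipation.Theorems.StrainedLayerLaw.LogEnstrophyClock

open Literature.Analysis.FluidPDE Literature.Analysis.FluidPDE.StretchedLayer
open Summit.AnomalousDissipation.AnomalousDissipation.Theses.MarginalStabilityChain
open Summit.AnomalousDissipation.AnomalousDissipation.Theorems.StrainedLayerLaw.StrainWorkSumRule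

/-- **Grönwall for the linear differential inequality `Ω′ = Ω − 2νP`, `P ≥ 0`, `ν ≥ 0` (pure real analysis).** If
`Ω` has derivative `Ω(τ) − 2νP(τ)` at every `τ > 0` with `P ≥ 0` there, then `Ω(τ) ≤ e^{τ−σ} Ω(σ)` for `0 < σ ≤ τ`:
`τ ↦ e^{−τ}Ω(τ)` has derivative `−2ν e^{−τ} P(τ) ≤ 0`, hence is antitone on `(0, ∞)`. [folklore] -/
theorem negEnstrophyExpLaw_of_hasDerivAt {ν : ℝ} (hν : 0 ≤ ν) {Ω P : ℝ → ℝ}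
    (hderiv : ∀ τ, 0 < τ → HasDerivAt Ω (Ω τ - 2 * ν * P τ) τ) (hP : ∀ τ, 0 < τ → 0 ≤ P τ)
    {σ τ : ℝ} (hσ : 0 < σ) (hστ : σ ≤ τ) : Ω τ ≤ Real.exp (τ - σ) * Ω σ := by
  -- the derivative of `g = e^{−·} Ω`
  have hg : ∀ r, 0 < r →
      HasDerivAt (fun x => Real.exp (-x) * Ω x) (-(Real.exp (-r) * (2 * ν * P r))) r := by
    intro r hr
    have h1 : HasDerivAt (fun x => Real.exp (-x)) (-Real.exp (-r)) r := by
      simpa using (hasDerivAt_neg r).exp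
    exact (h1.fun_mul (hderiv r hr)).congr_deriv (by ring)
  have hanti : AntitoneOn (fun x => Real.exp (-x) * Ω x) (Ioi 0) := by
    refine antitoneOn_of_hasDerivWithinAt_nonpos (f' := fun r => -(Real.exp (-r) * (2 * ν * P r)))
      (convex_Ioi 0) (fun r hr => (hg r hr).continuousAt.continuousWithinAt) ?_ ?_
    · rw [interior_Ioi]
      exact fun r hr => (hg r hr).hasDerivWithinAt
    · rw [interior_Ioi]
      intro r hr
      have := mul_nonneg (Real.exp_pos (-r)).le (mul_nonneg (mul_nonneg zero_le_two hν) (hP r hr))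
      linarith
  have h : Real.exp (-τ) * Ω τ ≤ Real.exp (-σ) * Ω σ := hanti hσ (hσ.trans_le hστ) hστ
  calc Ω τ = Real.exp τ * (Real.exp (-τ) * Ω τ) := by
        rw [← mul_assoc, ← Real.exp_add, add_neg_cancel, Real.exp_zero, one_mul]
    _ ≤ Real.exp τ * (Real.exp (-σ) * Ω σ) := mul_le_mul_of_nonneg_left h (Real.exp_pos τ).le
    _ = Real.exp (τ - σ) * Ω σ := by rw [← mul_assoc, ← Real.exp_add, sub_eq_add_neg]

/-- **The exponential law of the negative enstrophy and the cumulative negative-palinstrophy budget (registered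
sub-goal `negEnstrophy_exp_law` of line `FirstLemmasR2K4`).** Along every classical solution of the stretched layer
class on `(0, ∞)` (`ν, L > 0`) with shear tails on compact time intervals, for `0 < s ≤ t`:
`Ω₋(t) ≤ e^{t−s} Ω₋(s)` (Grönwall on the landed clock law `Ω₋′ = Ω₋ − 2νP₋`, `P₋ ≥ 0`) and
`∫_s^t 2νP₋ ≤ e^{t−s} Ω₋(s)` (the landed integral identity `Ω₋(t) − Ω₋(s) = ∫_s^t (Ω₋ − 2νP₋)`, the first bound
inside `∫_s^t Ω₋`, `∫_s^t e^{τ−s} dτ = e^{t−s} − 1`, and `Ω₋(t) ≥ 0`). [folklore] -/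
theorem negEnstrophy_exp_law : ∀ (ν L : ℝ), 0 < ν → 0 < L → ∀ (u v p : ℝ → ℝ → ℝ → ℝ), IsStretchedLayerNSSolutionOn (Ioi 0) ν 1 1 L u v p → (∀ a b : ℝ, 0 < a → a < b → ExpTails (Icc a b) u v) → ∀ s t : ℝ, 0 < s → s ≤ t → negEnstrophy L (u t) (v t) ≤ Real.exp (t - s) * negEnstrophy L (u s) (v s) ∧ ∫ τ in s..t, 2 * ν * negPalinstrophy L (u τ) (v τ) ≤ Real.exp (t - s) * negEnstrophy L (u s) (v s) := by
  intro ν L hν hL u v p hsol htails s t hs hst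
  set Ω : ℝ → ℝ := fun τ => negEnstrophy L (u τ) (v τ)
  set P : ℝ → ℝ := fun τ => negPalinstrophy L (u τ) (v τ)
  have hderiv : ∀ τ, 0 < τ → HasDerivAt Ω (Ω τ - 2 * ν * P τ) τ :=
    stub_negEnstrophyLaw stub_levelSetNull ν L hν hL u v p hsol htails
  have hP0 : ∀ τ, 0 < τ → 0 ≤ P τ := fun τ _ => negPalinstrophy_nonneg L (u τ) (v τ)
  -- (i) the exponential law between any two instants `0 < σ ≤ τ`
  have hexp : ∀ σ τ, 0 < σ → σ ≤ τ → Ω τ ≤ Real.exp (τ - σ) * Ω σ := fun σ τ hσ hστ =>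
    negEnstrophyExpLaw_of_hasDerivAt hν.le hderiv hP0 hσ hστ
  show Ω t ≤ Real.exp (t - s) * Ω s ∧ ∫ τ in s..t, 2 * ν * P τ ≤ Real.exp (t - s) * Ω s
  refine ⟨hexp s t hs hst, ?_⟩
  -- (ii) the budget: interval integrability of `Ω` and `2νP` on `[s, t]`
  have hgc : ContinuousOn (fun τ => Ω τ - 2 * ν * P τ) (Ioi 0) :=
    clock_negEnstrophy_continuousOn stub_levelSetNull hsol htails
  have hΩc : ContinuousOn Ω (Ioi 0) := fun τ hτ => (hderiv τ hτ).continuousAt.continuousWithinAt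
  have h2c : ContinuousOn (fun τ => 2 * ν * P τ) (Ioi 0) := by
    refine (hΩc.sub hgc).congr fun τ _ => ?_
    show 2 * ν * P τ = Ω τ - (Ω τ - 2 * ν * P τ)
    ring
  have hsub : uIcc s t ⊆ Ioi 0 := fun τ hτ => by
    rw [uIcc_of_le hst] at hτ; exact hs.trans_le hτ.1
  have hintΩ : IntervalIntegrable Ω volume s t := (hΩc.mono hsub).intervalIntegrable
  have hint2 : IntervalIntegrable (fun τ => 2 * ν * P τ) volume s t := (h2c.mono hsub).intervalIntegrable
  -- the landed identity, split
  have hid : Ω t - Ω s = ∫ τ in s..t, (Ω τ - 2 * ν * P τ) :=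
    clock_negEnstrophy_identity stub_levelSetNull hν hL hsol htails hs hst
  have hsplit : ∫ τ in s..t, (Ω τ - 2 * ν * P τ) = (∫ τ in s..t, Ω τ) - ∫ τ in s..t, 2 * ν * P τ :=
    intervalIntegral.integral_sub hintΩ hint2
  -- `∫_s^t Ω ≤ ∫_s^t e^{τ−s} Ω(s) dτ = (e^{t−s} − 1) Ω(s)`
  have hmono : ∫ τ in s..t, Ω τ ≤ ∫ τ in s..t, Real.exp (τ - s) * Ω s := by
    refine intervalIntegral.integral_mono_on hst hintΩ ?_ fun τ hτ => hexp s τ hs hτ.1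
    exact ((Real.continuous_exp.comp (continuous_sub_right s)).mul continuous_const).intervalIntegrable _ _
  have hval : ∫ τ in s..t, Real.exp (τ - s) * Ω s = (Real.exp (t - s) - 1) * Ω s := by
    rw [intervalIntegral.integral_mul_const, intervalIntegral.integral_comp_sub_right (fun x => Real.exp x) s,
      integral_exp, sub_self, Real.exp_zero]
  have hΩt : 0 ≤ Ω t := negEnstrophy_nonneg L (u t) (v t)
  rw [hsplit] at hid
  rw [hval] at hmono
  linarith [hid, hmono, hΩt]

end Summit.AnomalousDissipation.AnomalousDissipation.Theorems.StrainedLayerLaw.LogEnstrophyClock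

end
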